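import Summits.BirchSwinnertonDyer.Rank1Residual.P2.CountsAtTwoZhai16
import Literature.NumberTheory.EllipticCurves.ReductionAtTwoJValuationWindow
import HarnessLib

/-!
# K4 crux `AdditiveRankZeroAtTwo` (19098), child C3″ `AdditivePotGoodLowerHalfAtTwo` (22617): the ZHAI 2016 PRINT ROAD —
# `r_an = 0` and the LOWER half of BSD₂ on the twist families `V^{(M)}` (`M ≡ 1 (mod 4)`) of an `X₀`-optimal base `V` that is
# ADDITIVE and POTENTIALLY GOOD at `2` with `V[2]` IRREDUCIBLE — the «intrinsically additive, `E[2]`-irreducible» slice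

Cell `bsd-2adic`, seat `bsd-2adic-k4-w2` GEN 6 (prover, explicit unit, no kit); `--supports stmt-BirchSwinnertonDyer-22617 --as helper`.
HONEST FRAMING (D-0036/D-0054): kernel theorems; the named facts are Zhai 2016 Thm. 1.1 / Thm. 1.2 BY NAME
(`Zhai2016.thm11_ordTwo_LAlg_twist_eq_zero`, `Zhai2016.thm12_ordTwo_LAlg_twist_eq_one`: typed AS PRINTED by the b2b cell, nothing
asserted; flag-free at `2`: analytic rank ZERO statements about `ord₂(L(E^{(M)},1)/Ω_∞)`) and modularity (`hasEntireLFunction_rat`,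
for `L(W,1) ≠ 0 ⟺ r_an = 0`). NO Gross–Zagier–Kolyvagin binder (print gives `E^{(M)}(ℚ)` finite) and NO base certificate. The base
data are DISPLAYED exactly as in print: the `X₀(N)`-optimality datum (`Dt`, `hopt`) and the record `ord₂(L(V,1)/Ω_∞(V)) = 0`
(resp. `= 1`); the conditions on `M` are Zhai's. GEN 5's `E[2]`-irreducible road (`…PrintTwistLowerHalf{,ANS}.lean`, p680413/p680671)
covered the `C₂`-type twists `V^{(D)}`, `D ≢ 1 (mod 4)`, of curves `V` GOOD at `2`; this file covers the complementary shape: the base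
`V` is ITSELF additive potentially good at `2` and the twist is by `M ≡ 1 (mod 4)` (unramified at `2`), so every member has the
reduction type of `V` at `2` — read off `ord₂ j(V) ∈ [1, 11]` (k4-w1's window lemma `addv_two_of_padicValRat_j`, p668603) since
`j(V^{(M)}) = j(V)`. Closes nothing at the `∀`-level (C3″ is research-open: no Euler-system-free class-wide lower bound at an
additive `2`); the families are disjoint from the cell's residual census (there `ord₂ #Ш_an ≥ 4`; here `ord₂ #Ш_an ≤ 0`); nothing
booked; BSD is not proved by any of this.

CONTENTS (0 `def`, 0 `sorry`).
* §1 CORE `missingLowerBoundAt_two_of_isLAlg`: `W` globally minimal, `L(W,1) = x·Ω_∞(W)` (Zhai's `IsLAlg`), `x ≠ 0`, `W(ℚ)` finite,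
  `ord₂ x + 2·ord₂ #W(ℚ)_tors ≤ ord₂ c_∞(W)` ⇒ `r_an(W) = 0 ∧ MissingLowerBoundAt W 2`
  (`#Ш_an(W) = (x/c_∞)·#tors²/Tam(W)` has `ord₂ ≤ 0 ≤ ord₂ #Ш(W)`). Euler-system-free, reading-free.
* §2 `card_twoTorsion_eq_one_of_irr` (`Irr V 2 ⇒ #V(ℚ)[2] = 1`, Zhai's hypothesis shape) and the HABITAT transport
  `habitat_twist_of_jWindow`: `1 ≤ ord₂ j(V) ≤ 11`, `V` non-CM, `V[2]` irreducible ⇒ every model `W` of every twist `V^{(d)}` is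
  ADDITIVE and POTENTIALLY GOOD at `2`, NON-CM, `W[2]` irreducible.
* §3 ROAD (Thm. 1.1, `Δ(V) < 0`): `zhai11_lower` and the K4-keyed `printFamilyZhai11_lower`:
  `r_an(W) = 0 ∧ Addv W 2 ∧ 0 ≤ ord₂ j(W) ∧ ¬CM ∧ Irr W 2 ∧ MissingLowerBoundAt W 2` at every global minimal `W ≅ V^{(M)}`.
* §4 ROAD (Thm. 1.2, `Δ(V) > 0`, `M > 0`): `zhai12_lower`, `printFamilyZhai12_lower`.
Instances (bases `104A1`, `124B1`, `200E1`, `116B1`, `540A1`; `196B1`, `676D1` of Cremona's 1992 Table 1) are in the companion file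
`…AdditivePotGoodPrintZhaiIrreducibleInstances.lean`.

References: [Zhai2016] Thm. 1.1, Thm. 1.2 (Asian J. Math. 20 (2016) 475–502 = arXiv:1409.0231); [Miller2011LMS] Def. 1.1;
[CoatesLiTianZhai2015] §1 (1.3) (`Ω = c_∞·Ω_∞`); [Kraus1989] Prop. 2 / [SilvermanAEC2009] VII.5 (the `j`-window); [Mazur1978]
(irreducible `E[2]` ⇒ odd torsion).
-/

set_option autoImplicit false
set_option linter.dupNamespace false

noncomputable section

open scoped Classical

open WeierstrassCurve Literature.NumberTheory.EllipticCurves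
  Literature.NumberTheory.EllipticCurves.ModularForms
  Literature.NumberTheory.EllipticCurves.Rank1Residual
  Literature.NumberTheory.EllipticCurves.Rank1Residual.Typed
  Literature.NumberTheory.EllipticCurves.CoatesLiTianZhai2015
  Literature.NumberTheory.EllipticCurves.Zhai2016
  Summit.BirchSwinnertonDyer.Rank1Residual
  Summit.BirchSwinnertonDyer.Rank1Residual.P2

namespace Summit.BirchSwinnertonDyer.BirchSwinnertonDyer.Theorems.AddPotGoodPrint

/-! ## §1 CORE: an exact algebraic `L`-value of small `2`-adic size gives `r_an = 0` and the LOWER half -/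

/-- **CORE (Euler-system-free): an exact algebraic `L`-value of the right `2`-adic size gives the LOWER half of BSD₂.**
`W` globally minimal elliptic with `L(W,1) = x·Ω_∞(W)` (`Zhai2016.IsLAlg`, `Ω_∞` = least positive real period), `x ≠ 0`,
`W(ℚ)` finite, and `ord₂ x + 2·ord₂ #W(ℚ)_tors ≤ ord₂ c_∞(W)`. Then `r_an(W) = 0` (modularity) and `MissingLowerBoundAt W 2`:
`Ω(W) = c_∞·Ω_∞`, `Reg = 1`, so `#Ш_an(W) = (x/c_∞)·#tors²/Tam(W)` with
`ord₂ #Ш_an = ord₂ x − ord₂ c_∞ + 2·ord₂ #tors − ord₂ Tam ≤ 0 ≤ ord₂ #Ш(W)`. No reading, no instrument.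
[cite: Zhai2016, §1 (the convention L^alg = L/Ω_∞)] [cite: CoatesLiTianZhai2015, §1 (1.3)] [cite: Miller2011LMS, Def. 1.1] -/
theorem missingLowerBoundAt_two_of_isLAlg (hmod : hasEntireLFunction_rat) (W : WeierstrassCurve ℚ) [W.IsElliptic]
    [W.IsGloballyMinimal] {x : ℚ} (hx : IsLAlg W x) (hx0 : x ≠ 0) (hfinPt : Finite W.toAffine.Point)
    (hv : padicValRat 2 x + 2 * (padicValNat 2 W.torsionOrder : ℤ) ≤ (padicValNat 2 (W.baseChange ℝ).numRealComponents : ℤ)) :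
    W.analyticRank = 0 ∧ MissingLowerBoundAt W 2 := by
  haveI : Fact (Nat.Prime 2) := ⟨Nat.prime_two⟩
  have hcpos := WeierstrassCurve.numRealComponents_pos (W.baseChange ℝ)
  have hOmega : leastRealPeriod W ≠ 0 := by
    unfold leastRealPeriod
    exact div_ne_zero W.realPeriodRat_pos_holds.ne' (by exact_mod_cast hcpos.ne')
  have hLne : W.entireLFunction 1 ≠ 0 := entireLFunction_one_ne_zero_of_isLAlg hx hx0 hOmega
  have hr : W.analyticRank = 0 := (W.analyticRank_eq_zero_iff_holds (hmod W)).2 hLne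
  have hrk : W.mordellWeilRank = 0 := mordellWeilRank_eq_zero_of_finite W hfinPt
  have hL := leadingLCoeff_eq_of_isLAlg W hx hr hrk
  have hreg := W.regulator_eq_one_of_rank_zero hrk
  have ht0 := W.torsionOrder_pos_holds
  have hT0 : 0 < W.tamagawaProduct := W.tamagawaProduct_pos_holds
  have hΩ0 : W.realPeriodRat ≠ 0 := W.realPeriodRat_pos_holds.ne'
  refine ⟨hr, x / ((W.baseChange ℝ).numRealComponents : ℚ) * (W.torsionOrder : ℚ) ^ 2 / W.tamagawaProduct, ?_, ?_⟩
  · -- `#Ш_an(W) = (x/c_∞)·#tors²/Tam`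
    have hΩC : ((W.realPeriodRat : ℝ) : ℂ) ≠ 0 := by exact_mod_cast hΩ0
    have hTC : ((W.tamagawaProduct : ℕ) : ℂ) ≠ 0 := by exact_mod_cast hT0.ne'
    have hcC : (((W.baseChange ℝ).numRealComponents : ℕ) : ℂ) ≠ 0 := by exact_mod_cast hcpos.ne'
    rw [shaAn_def, hL, hreg]
    push_cast
    field_simp
  · -- valuations
    have hc0' : ((W.baseChange ℝ).numRealComponents : ℚ) ≠ 0 := by exact_mod_cast hcpos.ne'
    have ht0' : (W.torsionOrder : ℚ) ≠ 0 := by exact_mod_cast ht0.ne'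
    have hT0' : (W.tamagawaProduct : ℚ) ≠ 0 := by exact_mod_cast hT0.ne'
    rw [padicValRat.div (mul_ne_zero (div_ne_zero hx0 hc0') (pow_ne_zero 2 ht0')) hT0',
      padicValRat.mul (div_ne_zero hx0 hc0') (pow_ne_zero 2 ht0'), padicValRat.div hx0 hc0', padicValRat.pow,
      padicValRat.of_nat, padicValRat.of_nat, padicValRat.of_nat]
    have h1 : (0 : ℤ) ≤ (padicValNat 2 W.shaOrder : ℤ) := Int.natCast_nonneg _
    have h2 : (0 : ℤ) ≤ (padicValNat 2 W.tamagawaProduct : ℤ) := Int.natCast_nonneg _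
    simp only [Nat.cast_ofNat]
    linarith

/-! ## §2 Zhai's `#E(ℚ)[2] = 1` from `Irr`, and the K4 habitat of every twist from the `2`-adic `j`-window -/

/-- `E[2]` irreducible ⇒ `#E(ℚ)[2] = 1` (the printed hypothesis shape «`E[2](ℚ) = 0`» of Zhai 2016).
[cite: Zhai2016, Thm. 1.1 (hypothesis E[2](ℚ) = 0)] -/
theorem card_twoTorsion_eq_one_of_irr (V : WeierstrassCurve ℚ) [V.IsElliptic]
    (hirr : haveI : Fact (Nat.Prime 2) := ⟨Nat.prime_two⟩; Irr V 2) :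
    Nat.card {P : V.toAffine.Point // (2 : ℕ) • P = 0} = 1 := by
  haveI : Fact (Nat.Prime 2) := ⟨Nat.prime_two⟩
  have h := (X5.O1.irr_two_iff_forall_two_nsmul V).mp hirr
  haveI : Subsingleton {P : V.toAffine.Point // (2 : ℕ) • P = 0} :=
    ⟨fun a b => Subtype.ext ((h a.1 a.2).trans (h b.1 b.2).symm)⟩
  haveI : Nonempty {P : V.toAffine.Point // (2 : ℕ) • P = 0} := ⟨⟨0, by simp⟩⟩
  exact Nat.card_eq_one_iff_unique.mpr ⟨‹_›, ‹_›⟩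

/-- **HABITAT of every twist from the `2`-adic `j`-window.** `V` with `1 ≤ ord₂ j(V) ≤ 11`, non-CM, `V[2]` irreducible; `d ≠ 0`;
`W` any model of `V^{(d)}` (`C • V^{(d)} = W`). Then `W` is ADDITIVE at `2` and POTENTIALLY GOOD (`j(W) = j(V)`; the window
lemma `addv_two_of_padicValRat_j`: good at `2` forces `ord₂ j ∈ {0} ∪ [12, ∞)`, multiplicative forces `ord₂ j < 0`), NON-CM
(`j` is a CM invariant iff it is one of the thirteen, `hasCM_iff_j_mem_holds`) and `W[2]` is IRREDUCIBLE (twist invariance,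
`P2.irr_two_iff_of_twist`). [cite: Kraus1989, Prop. 2] [cite: SilvermanAEC2009, VII.5 Prop. 5.1 and 5.5, X.5, App. C §11] -/
theorem habitat_twist_of_jWindow (V : WeierstrassCurve ℚ) [V.IsElliptic] (hj1 : 1 ≤ padicValRat 2 V.j)
    (hj11 : padicValRat 2 V.j ≤ 11) (hcm : ¬ V.HasCM)
    (hirr : haveI : Fact (Nat.Prime 2) := ⟨Nat.prime_two⟩; Irr V 2) {d : ℚ} (hd : d ≠ 0)
    (W : WeierstrassCurve ℚ) [W.IsElliptic] (hW : ∃ C : VariableChange ℚ, C • V.quadraticTwist d = W) :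
    haveI : Fact (Nat.Prime 2) := ⟨Nat.prime_two⟩
    Addv W 2 ∧ 0 ≤ padicValRat 2 W.j ∧ ¬ W.HasCM ∧ Irr W 2 := by
  haveI : Fact (Nat.Prime 2) := ⟨Nat.prime_two⟩
  haveI := V.isElliptic_quadraticTwist hd
  have hirrW : Irr W 2 := (irr_two_iff_of_twist V hd hW).mp hirr
  obtain ⟨C, rfl⟩ := hW
  have hjW : (C • V.quadraticTwist d).j = V.j := by rw [variableChange_j, j_quadraticTwist V hd]
  refine ⟨?_, by rw [hjW]; linarith, fun hW => hcm ?_, hirrW⟩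
  · have h := addv_two_of_padicValRat_j (C • V.quadraticTwist d) (by rw [hjW]; exact hj1) (by rw [hjW]; exact hj11)
    exact h
  · exact (WeierstrassCurve.hasCM_iff_j_mem_holds V).mpr
      (hjW ▸ (WeierstrassCurve.hasCM_iff_j_mem_holds (C • V.quadraticTwist d)).mp hW)

/-! ## §3 ROAD from Zhai 2016 Thm. 1.1 (`Δ(V) < 0`, `ord₂ L^{alg}(V) = 0`) -/

/-- **Zhai 2016 Thm. 1.1 ⇒ `r_an = 0` and the LOWER half at every global minimal model of `V^{(M)}`.** Hypotheses VERBATIM as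
typed (`Zhai2016.thm11_ordTwo_LAlg_twist_eq_zero`): `V` `Γ₀(N)`-optimal (`Dt`, `hopt`), `Δ(V) < 0`, `V[2]` irreducible (`#V(ℚ)[2] = 1`),
the record `ord₂(L(V,1)/Ω_∞(V)) = 0` (`hL`), `F` the cubic `2`-division field, `M` square-free, `M ≡ 1 (mod 4)`, `(M, N) = 1`, with
`r ≥ 1` odd prime factors all inert in `F`, `W` a global minimal model of `V^{(M)}`; modularity. Print: `ord₂(L(W,1)/Ω_∞(W)) = 0`,
`W(ℚ)` finite. Since `Δ(W) < 0` (`c_∞ = 1`) and `W[2]` is irreducible (odd torsion), §1 applies with `0 + 0 ≤ 0`.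
[cite: Zhai2016, Thm. 1.1 (arXiv:1409.0231 chunk p0002 L22–L29)] [cite: Miller2011LMS, Def. 1.1] -/
theorem zhai11_lower (h11 : thm11_ordTwo_LAlg_twist_eq_zero) (hmod : hasEntireLFunction_rat)
    (V : WeierstrassCurve ℚ) [V.IsElliptic] [V.IsGloballyMinimal] [NeZero (V.conductorNorm ℤ)]
    (Dt : ModularParametrizationData V (V.conductorNorm ℤ)) (hopt : Zhai2021.IsOptimalDatum V Dt) (hΔ : V.Δ < 0)
    (hirr : haveI : Fact (Nat.Prime 2) := ⟨Nat.prime_two⟩; Irr V 2)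
    (hL : ∃ x : ℚ, IsLAlg V x ∧ x ≠ 0 ∧ padicValRat 2 x = 0)
    (F : Type) [Field F] [NumberField F] (hF : IsTwoDivisionField V F)
    (M : ℤ) (hsq : Squarefree M) (hM4 : M % 4 = 1) (hgcd : Int.gcd M (V.conductorNorm ℤ) = 1)
    (hne : M.natAbs.primeFactors.Nonempty) (hin : ∀ q ∈ M.natAbs.primeFactors, q ≠ 2 ∧ IsInertIn F q)
    (W : WeierstrassCurve ℚ) [W.IsElliptic] [W.IsGloballyMinimal]
    (hW : ∃ C : VariableChange ℚ, C • V.quadraticTwist (M : ℚ) = W) :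
    W.analyticRank = 0 ∧ MissingLowerBoundAt W 2 := by
  haveI : Fact (Nat.Prime 2) := ⟨Nat.prime_two⟩
  obtain ⟨⟨x, hx, hx0, hv⟩, -, hfinPt, -⟩ :=
    h11 V Dt hopt hΔ (card_twoTorsion_eq_one_of_irr V hirr) hL F hF M hsq hM4 hgcd hne hin W hW
  have hM0 : (M : ℚ) ≠ 0 := by exact_mod_cast hsq.ne_zero
  have hΔW : W.Δ < 0 := by
    have hnot : ¬ 0 < W.Δ := fun h' => absurd ((Δ_pos_iff_of_twist V hM0 hW).mpr h') (not_lt.mpr hΔ.le)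
    exact lt_of_le_of_ne (not_lt.mp hnot) W.isUnit_Δ.ne_zero
  have hc : (W.baseChange ℝ).numRealComponents = 1 := numRealComponents_eq_one_of_Δ_neg hΔW
  have hirrW : Irr W 2 := (irr_two_iff_of_twist V hM0 hW).mp hirr
  have htor : padicValNat 2 W.torsionOrder = 0 := padicValNat_torsionOrder_eq_zero_of_irreducible W 2 hirrW
  exact missingLowerBoundAt_two_of_isLAlg hmod W hx hx0 hfinPt (by rw [hv, htor, hc]; simp)

/-- **THE ZHAI-1.1 PRINT ROAD, K4-keyed.** For an `X₀(N)`-optimal base `V` (datum displayed) with `Δ(V) < 0`, `V[2]` irreducible,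
`1 ≤ ord₂ j(V) ≤ 11` (so `V` is ADDITIVE, POTENTIALLY GOOD at `2`), non-CM, and the record `ord₂(L(V,1)/Ω_∞(V)) = 0`: at EVERY global
minimal `W ≅ V^{(M)}` (`M` as in Zhai's Thm. 1.1) the C3″ binders are decided — `r_an(W) = 0`, `Addv W 2`, `0 ≤ ord₂ j(W)`, `¬CM`,
`Irr W 2` — and the LOWER half `MissingLowerBoundAt W 2` HOLDS. Inputs BY NAME: Zhai 2016 Thm. 1.1, modularity. No GZK, no reading,
no instrument, no base certificate. BSD is not proved by any of this. [cite: Zhai2016, Thm. 1.1] [cite: Miller2011LMS, Def. 1.1] -/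
theorem printFamilyZhai11_lower (h11 : thm11_ordTwo_LAlg_twist_eq_zero) (hmod : hasEntireLFunction_rat)
    (V : WeierstrassCurve ℚ) [V.IsElliptic] [V.IsGloballyMinimal] [NeZero (V.conductorNorm ℤ)]
    (Dt : ModularParametrizationData V (V.conductorNorm ℤ)) (hopt : Zhai2021.IsOptimalDatum V Dt) (hΔ : V.Δ < 0)
    (hirr : haveI : Fact (Nat.Prime 2) := ⟨Nat.prime_two⟩; Irr V 2)
    (hj1 : 1 ≤ padicValRat 2 V.j) (hj11 : padicValRat 2 V.j ≤ 11) (hcm : ¬ V.HasCM)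
    (hL : ∃ x : ℚ, IsLAlg V x ∧ x ≠ 0 ∧ padicValRat 2 x = 0)
    (F : Type) [Field F] [NumberField F] (hF : IsTwoDivisionField V F)
    (M : ℤ) (hsq : Squarefree M) (hM4 : M % 4 = 1) (hgcd : Int.gcd M (V.conductorNorm ℤ) = 1)
    (hne : M.natAbs.primeFactors.Nonempty) (hin : ∀ q ∈ M.natAbs.primeFactors, q ≠ 2 ∧ IsInertIn F q)
    (W : WeierstrassCurve ℚ) [W.IsElliptic] [W.IsGloballyMinimal]
    (hW : ∃ C : VariableChange ℚ, C • V.quadraticTwist (M : ℚ) = W) :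
    haveI : Fact (Nat.Prime 2) := ⟨Nat.prime_two⟩
    W.analyticRank = 0 ∧ Addv W 2 ∧ 0 ≤ padicValRat 2 W.j ∧ ¬ W.HasCM ∧ Irr W 2 ∧ MissingLowerBoundAt W 2 := by
  haveI : Fact (Nat.Prime 2) := ⟨Nat.prime_two⟩
  have hM0 : (M : ℚ) ≠ 0 := by exact_mod_cast hsq.ne_zero
  obtain ⟨hr, hlow⟩ := zhai11_lower h11 hmod V Dt hopt hΔ hirr hL F hF M hsq hM4 hgcd hne hin W hW
  obtain ⟨hadd, hj, hcmW, hirrW⟩ := habitat_twist_of_jWindow V hj1 hj11 hcm hirr hM0 W hW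
  exact ⟨hr, hadd, hj, hcmW, hirrW, hlow⟩

/-! ## §4 ROAD from Zhai 2016 Thm. 1.2 (`Δ(V) > 0`, `ord₂ L^{alg}(V) = 1`, `M > 0`) -/

/-- **Zhai 2016 Thm. 1.2 ⇒ `r_an = 0` and the LOWER half at every global minimal model of `V^{(M)}`, `M > 0`.** As Thm. 1.1 but
`Δ(V) > 0` and the record `ord₂(L(V,1)/Ω_∞(V)) = 1`; print: `ord₂(L(W,1)/Ω_∞(W)) = 1`, `W(ℚ)` finite. Since `Δ(W) > 0` the BSD
period is `2Ω_∞` (`c_∞ = 2`), so §1 applies with `1 + 0 ≤ 1`.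
[cite: Zhai2016, Thm. 1.2 (arXiv:1409.0231 chunk p0003 L11–L18)] [cite: Miller2011LMS, Def. 1.1] -/
theorem zhai12_lower (h12 : thm12_ordTwo_LAlg_twist_eq_one) (hmod : hasEntireLFunction_rat)
    (V : WeierstrassCurve ℚ) [V.IsElliptic] [V.IsGloballyMinimal] [NeZero (V.conductorNorm ℤ)]
    (Dt : ModularParametrizationData V (V.conductorNorm ℤ)) (hopt : Zhai2021.IsOptimalDatum V Dt) (hΔ : 0 < V.Δ)
    (hirr : haveI : Fact (Nat.Prime 2) := ⟨Nat.prime_two⟩; Irr V 2)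
    (hL : ∃ x : ℚ, IsLAlg V x ∧ x ≠ 0 ∧ padicValRat 2 x = 1)
    (F : Type) [Field F] [NumberField F] (hF : IsTwoDivisionField V F)
    (M : ℤ) (hMpos : 0 < M) (hsq : Squarefree M) (hM4 : M % 4 = 1) (hgcd : Int.gcd M (V.conductorNorm ℤ) = 1)
    (hne : M.natAbs.primeFactors.Nonempty) (hin : ∀ q ∈ M.natAbs.primeFactors, q ≠ 2 ∧ IsInertIn F q)
    (W : WeierstrassCurve ℚ) [W.IsElliptic] [W.IsGloballyMinimal]
    (hW : ∃ C : VariableChange ℚ, C • V.quadraticTwist (M : ℚ) = W) :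
    W.analyticRank = 0 ∧ MissingLowerBoundAt W 2 := by
  haveI : Fact (Nat.Prime 2) := ⟨Nat.prime_two⟩
  obtain ⟨⟨x, hx, hx0, hv⟩, -, hfinPt, -⟩ :=
    h12 V Dt hopt hΔ (card_twoTorsion_eq_one_of_irr V hirr) hL F hF M hMpos hsq hM4 hgcd hne hin W hW
  have hM0 : (M : ℚ) ≠ 0 := by exact_mod_cast hsq.ne_zero
  have hΔW : 0 < W.Δ := (Δ_pos_iff_of_twist V hM0 hW).mp hΔ
  have hc : (W.baseChange ℝ).numRealComponents = 2 := numRealComponents_eq_two_of_Δ_pos hΔW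
  have hirrW : Irr W 2 := (irr_two_iff_of_twist V hM0 hW).mp hirr
  have htor : padicValNat 2 W.torsionOrder = 0 := padicValNat_torsionOrder_eq_zero_of_irreducible W 2 hirrW
  have h2 : padicValNat 2 2 = 1 := by simp
  exact missingLowerBoundAt_two_of_isLAlg hmod W hx hx0 hfinPt (by rw [hv, htor, hc, h2]; simp)

/-- **THE ZHAI-1.2 PRINT ROAD, K4-keyed** (`Δ(V) > 0`, `M > 0`, record `ord₂(L(V,1)/Ω_∞(V)) = 1`): at EVERY global minimal
`W ≅ V^{(M)}` the C3″ binders are decided and the LOWER half `MissingLowerBoundAt W 2` HOLDS. Inputs BY NAME: Zhai 2016 Thm. 1.2,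
modularity. BSD is not proved by any of this. [cite: Zhai2016, Thm. 1.2] [cite: Miller2011LMS, Def. 1.1] -/
theorem printFamilyZhai12_lower (h12 : thm12_ordTwo_LAlg_twist_eq_one) (hmod : hasEntireLFunction_rat)
    (V : WeierstrassCurve ℚ) [V.IsElliptic] [V.IsGloballyMinimal] [NeZero (V.conductorNorm ℤ)]
    (Dt : ModularParametrizationData V (V.conductorNorm ℤ)) (hopt : Zhai2021.IsOptimalDatum V Dt) (hΔ : 0 < V.Δ)
    (hirr : haveI : Fact (Nat.Prime 2) := ⟨Nat.prime_two⟩; Irr V 2)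
    (hj1 : 1 ≤ padicValRat 2 V.j) (hj11 : padicValRat 2 V.j ≤ 11) (hcm : ¬ V.HasCM)
    (hL : ∃ x : ℚ, IsLAlg V x ∧ x ≠ 0 ∧ padicValRat 2 x = 1)
    (F : Type) [Field F] [NumberField F] (hF : IsTwoDivisionField V F)
    (M : ℤ) (hMpos : 0 < M) (hsq : Squarefree M) (hM4 : M % 4 = 1) (hgcd : Int.gcd M (V.conductorNorm ℤ) = 1)
    (hne : M.natAbs.primeFactors.Nonempty) (hin : ∀ q ∈ M.natAbs.primeFactors, q ≠ 2 ∧ IsInertIn F q)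
    (W : WeierstrassCurve ℚ) [W.IsElliptic] [W.IsGloballyMinimal]
    (hW : ∃ C : VariableChange ℚ, C • V.quadraticTwist (M : ℚ) = W) :
    haveI : Fact (Nat.Prime 2) := ⟨Nat.prime_two⟩
    W.analyticRank = 0 ∧ Addv W 2 ∧ 0 ≤ padicValRat 2 W.j ∧ ¬ W.HasCM ∧ Irr W 2 ∧ MissingLowerBoundAt W 2 := by
  haveI : Fact (Nat.Prime 2) := ⟨Nat.prime_two⟩
  have hM0 : (M : ℚ) ≠ 0 := by exact_mod_cast hsq.ne_zero
  obtain ⟨hr, hlow⟩ := zhai12_lower h12 hmod V Dt hopt hΔ hirr hL F hF M hMpos hsq hM4 hgcd hne hin W hW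
  obtain ⟨hadd, hj, hcmW, hirrW⟩ := habitat_twist_of_jWindow V hj1 hj11 hcm hirr hM0 W hW
  exact ⟨hr, hadd, hj, hcmW, hirrW, hlow⟩

end Summit.BirchSwinnertonDyer.BirchSwinnertonDyer.Theorems.AddPotGoodPrint

end
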